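import Summits.NavierStokesRegularity.NavierStokesRegularity.Theorems.FilamentSkeletonRssCoreLinearInvertibilityModuloMaekawa
import Literature.Analysis.FluidPDE.AsymBurgersLinearizedEvenInvertibilityProofs

/-!
# Route FilamentSkeletonRss · crux `CoreLinearInvertibility` (stmt-NavierStokesRegularity-17973) — PROVED

`CoreLinearInvertibility`: for every asymmetry `λ ∈ [0,1)` there are `R₀, c > 0` such that for all
`R ≥ R₀` the linearised strained planar core operator at the Gaussian core,
`T_{λ,R} w = L_λ w − R (v^G·∇w + (K_{2D}∗w)·∇G)`, obeys `c² ∫ G_λ⁻¹ w² ≤ ∫ G_λ⁻¹ (T_{λ,R} w)²`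
for every `C²` vorticity `w` with `w, T w ∈ X_λ = L²(G_λ⁻¹)`, pointwise convergent Biot–Savart
integrals and zero mass and first moments.

Assembly of line `Sketch` (lead sessions prover-line-stmt-NavierStokesRegularity-17973-0 / -c1):
the conditional composition `coreLinearInvertibility_of_maekawa` (Theorems/…ModuloMaekawa.lean, p171636:
class closure + parity split + `λ = 0` energy bound + the unconditional ODD sector via the forward
symmetrizer, Gallay–Šverák's Arnold coercivity at the Gaussian and the high-rotation attenuation of
`L_λ − RΩ∂_θ`) applied to the tree's discharge `Maekawa2009_evenSectorInverseBound_holds`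
(Literature/Analysis/FluidPDE/AsymBurgersLinearizedEvenInvertibilityProofs.lean: Maekawa 2009, M3AS 19,
Lemma 4.1 — the even-sector uniform inverse bound, proved quantitatively with `C² = 1 + 3432/(1−λ)²`).
-/

set_option linter.dupNamespace false

noncomputable section

namespace Summit.NavierStokesRegularity.NavierStokesRegularity.Theorems

/-- Registered stub `stub_maekawa2009Even` of crux stmt-NavierStokesRegularity-17973 (line `Sketch`, skeleton v5):
Maekawa's even-sector inverse bound, now a theorem of the tree
(`Literature.Analysis.FluidPDE.Maekawa2009_evenSectorInverseBound_holds`). [cite: Maekawa2009b, §4 Lemma 4.1 (4.1)] -/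
theorem stub_maekawa2009Even : Literature.Analysis.FluidPDE.Maekawa2009_evenSectorInverseBound :=
  Literature.Analysis.FluidPDE.Maekawa2009_evenSectorInverseBound_holds

/-- **`CoreLinearInvertibility` (crux stmt-NavierStokesRegularity-17973), proved.** The uniform-in-`R ≥ R₀`
inverse bound for the linearised strained core operator `T_{λ,R}` at the Gaussian, for every asymmetry
`λ ∈ [0,1)`, on the crux's maximal-domain class with zero mass and first moments:
`coreLinearInvertibility_of_maekawa` (all stubs of line `Sketch` landed) fed with the proved even-sector
input `stub_maekawa2009Even`. -/
theorem coreLinearInvertibility_proof :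
    Summit.NavierStokesRegularity.NavierStokesRegularity.Theses.FilamentSkeletonRss.CoreLinearInvertibility :=
  coreLinearInvertibility_of_maekawa stub_maekawa2009Even

end Summit.NavierStokesRegularity.NavierStokesRegularity.Theorems
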